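import Mathlib.Tactic
import HarnessLib

/-!
# BirchSwinnertonDyer — rank ≥ 2 observatory: the Pollack–Weston λ-shift `q_n`
(instruments U3-MTL / U3-SS / U3SS-L8, guard G5)

HONEST FRAMING: per-curve certified theorems and census instruments; no claim on BSD in rank ≥ 2.

For a `p`-non-ordinary weight-2 form, Pollack–Weston [cite: PollackWeston2011MT, §1, eq. (1) on p. 1 and the definition of q_n below it]
record that the λ-invariant of the Mazur–Tate element `θ_n` grows as `λ(θ_n) = q_n + λ^±` with
`q_n = p^{n-1} - p^{n-2} + ⋯ + p - 1` (`n` even) and `q_n = p^{n-1} - p^{n-2} + ⋯ + p² - p` (`n` odd).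
The census instruments (`SCHNEIDER-CENSUS.md` §3.8 U3-MTL, §3.9 U3-SS guard G5, `PREREG-U3SS-L8.md`
G5⁸) subtract exactly these shifts from the λ read off the level-`pⁿ` series: `q_4 = 20`, `q_5 = 60`
at levels `3⁵, 3⁶` and `q_6 = 182`, `q_7 = 546` at levels `3⁷, 3⁸`.  Nothing about modular forms is
formalised here; this file pins down the elementary arithmetic of `q_n` that the bookkeeping uses:
a subtraction-free recursion, the closed forms `(p+1)·q_n + 1 = pⁿ` (`n` even) and
`(p+1)·q_n + p = pⁿ` (`n` odd), the odd-step identity `q_{2m+1} = p·q_{2m}`, and the four values at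
`p = 3`.  (The companion file `Rank2ObservatorySignedLayer.lean` shows the same `20` and `60` arise as
`deg Φ₃Φ₂₇` and `deg Φ₉Φ₈₁`, i.e. as the cyclotomic factors divided out of the signed series.)
-/

namespace Summit.BirchSwinnertonDyer.BirchSwinnertonDyer.Rank2Observatory

/-- The Pollack–Weston shift, by the subtraction-free recursion
`q_0 = 0`, `q_{n+1} = p·q_n + (p - 1 if n+1 is even, else 0)`. -/
def qPW (p : ℕ) : ℕ → ℕ
  | 0 => 0
  | n + 1 => p * qPW p n + if Even (n + 1) then p - 1 else 0

/-- `q_0 = 0`. -/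
@[simp] theorem qPW_zero (p : ℕ) : qPW p 0 = 0 := rfl

/-- The defining recursion step, as a rewrite lemma. -/
theorem qPW_succ (p n : ℕ) :
    qPW p (n + 1) = p * qPW p n + if Even (n + 1) then p - 1 else 0 := rfl

/-- Odd step: `q_{2m+1} = p · q_{2m}`. -/
theorem qPW_odd_step (p m : ℕ) : qPW p (2 * m + 1) = p * qPW p (2 * m) := by
  rw [qPW_succ]
  have h : ¬ Even (2 * m + 1) := by
    rw [Nat.not_even_iff_odd]; exact ⟨m, rfl⟩
  simp [h]

/-- Even step: `q_{2m+2} = p · q_{2m+1} + (p - 1)`. -/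
theorem qPW_even_step (p m : ℕ) : qPW p (2 * m + 2) = p * qPW p (2 * m + 1) + (p - 1) := by
  rw [show 2 * m + 2 = (2 * m + 1) + 1 from rfl, qPW_succ]
  have h : Even (2 * m + 1 + 1) := ⟨m + 1, by ring⟩
  simp [h]

/-- Closed form at even index: `(p+1)·q_{2m} + 1 = p^{2m}` (for `p ≥ 1`). -/
theorem qPW_closed_even (p m : ℕ) (hp : 1 ≤ p) : (p + 1) * qPW p (2 * m) + 1 = p ^ (2 * m) := by
  induction m with
  | zero => simp
  | succ m ih =>
    rw [show 2 * (m + 1) = 2 * m + 2 from by ring, qPW_even_step, qPW_odd_step]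
    have e : p ^ (2 * m + 2) = p ^ 2 * p ^ (2 * m) := by ring
    rw [e, ← ih]
    obtain ⟨k, rfl⟩ : ∃ k, p = k + 1 := ⟨p - 1, by omega⟩
    simp only [Nat.add_sub_cancel]
    ring

/-- Closed form at odd index: `(p+1)·q_{2m+1} + p = p^{2m+1}` (for `p ≥ 1`). -/
theorem qPW_closed_odd (p m : ℕ) (hp : 1 ≤ p) :
    (p + 1) * qPW p (2 * m + 1) + p = p ^ (2 * m + 1) := by
  rw [qPW_odd_step, pow_succ, ← qPW_closed_even p m hp]
  ring

/-- Two-step (grouped) recursion at even indices, the form in which the instrument tabulates the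
shift level by level: `q_{2m+2} = p²·q_{2m} + (p - 1)`. -/
theorem qPW_even_grouped (p m : ℕ) :
    qPW p (2 * m + 2) = p ^ 2 * qPW p (2 * m) + (p - 1) := by
  rw [qPW_even_step, qPW_odd_step]; ring

/-- The four shifts used by the census at `p = 3`: levels `3⁵, 3⁶` (U3-MTL, U3-SS guard G5) and
`3⁷, 3⁸` (U3SS-L8 guard G5⁸). -/
theorem qPW_three_values :
    qPW 3 4 = 20 ∧ qPW 3 5 = 60 ∧ qPW 3 6 = 182 ∧ qPW 3 7 = 546 := by
  refine ⟨?_, ?_, ?_, ?_⟩ <;> decide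

/-- Consistency with the cyclotomic degrees of `Rank2ObservatorySignedLayer.signedOffsets_p3`:
`q_4 = φ(3) + φ(3³) = 2 + 18` and `q_5 = φ(3²) + φ(3⁴) = 6 + 54`; generally the even / odd shifts
are the sums of `φ(p^k) = p^k - p^{k-1}` over odd / even `k`. Stated at `p = 3` for the four levels. -/
theorem qPW_three_as_totient_sums :
    qPW 3 4 = Nat.totient 3 + Nat.totient 27 ∧ qPW 3 5 = Nat.totient 9 + Nat.totient 81 ∧
    qPW 3 6 = Nat.totient 3 + Nat.totient 27 + Nat.totient 243 ∧
    qPW 3 7 = Nat.totient 9 + Nat.totient 81 + Nat.totient 729 := by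
  have t3 : Nat.totient 3 = 2 := by
    rw [show (3:ℕ) = 3 ^ 1 from rfl, Nat.totient_prime_pow Nat.prime_three (by norm_num)]; all_goals norm_num
  have t9 : Nat.totient 9 = 6 := by
    rw [show (9:ℕ) = 3 ^ 2 from rfl, Nat.totient_prime_pow Nat.prime_three (by norm_num)]; all_goals norm_num
  have t27 : Nat.totient 27 = 18 := by
    rw [show (27:ℕ) = 3 ^ 3 from rfl, Nat.totient_prime_pow Nat.prime_three (by norm_num)]; all_goals norm_num
  have t81 : Nat.totient 81 = 54 := by
    rw [show (81:ℕ) = 3 ^ 4 from rfl, Nat.totient_prime_pow Nat.prime_three (by norm_num)]; all_goals norm_num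
  have t243 : Nat.totient 243 = 162 := by
    rw [show (243:ℕ) = 3 ^ 5 from rfl, Nat.totient_prime_pow Nat.prime_three (by norm_num)]; all_goals norm_num
  have t729 : Nat.totient 729 = 486 := by
    rw [show (729:ℕ) = 3 ^ 6 from rfl, Nat.totient_prime_pow Nat.prime_three (by norm_num)]; all_goals norm_num
  rw [t3, t9, t27, t81, t243, t729]
  refine ⟨?_, ?_, ?_, ?_⟩ <;> decide

end Summit.BirchSwinnertonDyer.BirchSwinnertonDyer.Rank2Observatory
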